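import Literature.Analysis.Fourier.HilbertTransformLineSplit
import Literature.Analysis.FluidPDE.GCLMSelfSimilarBlowup
import Summits.NavierStokesRegularity.OSWSelfSimilar.SheetRowThirdHilbert
import HarnessLib

/-!
# The inviscid end of the `c_l = 1/3` row is an UNCONDITIONAL exact self-similar blow-up of the gCLM at `a = 1/2`
# (Chen 2020 eq. (2.3) / Lushnikov–Silantyev–Siegel 2021 Thm 2, kernel-checked end to end)

HONEST FRAMING (cell ns-blowup GROUP B «PROFILE SEARCH» zone Z3 / seat ns-blowup-selfsim): **1-D MODEL (inviscid generalised
Constantin–Lax–Majda / Okamoto–Sakajo–Wunsch equation on `ℝ`), not Euler, not Navier–Stokes; «violates: none — MODEL».**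

THE THEOREM (no named fact, no side condition, no cited gap). Let `Ω(x) = −(16/3)·x/(1+x²)²` (the exact `a = 1/2`
collapse profile [cite: Chen2020DissipativeGCLM, eq. (2.3)], [cite: LushnikovSilantyevSiegel2021, Thm. 2]; the `ε = 0`, `ℓ = 1`
member of the sheet's `c_l = 1/3` row, `SheetRowThirdExactFamily.inviscid_edge`). Then
* `Ω` solves the self-similar profile equation of the gCLM on the line, `(⅓X + ½U)Ω′ = (−1 + HΩ)Ω`, `U = ∫₀ˣHΩ`, at EVERY `X`
  (`GCLMProfileEqAt (1/2) (1/3) (−1) Ω X` of `HuangQinWangWei2024SelfSimilarGCLM.lean`, with the tree's p.v. operator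
  `lineHilbert` and velocity `lineVelocity`) — `profileEq_half`;
* hence for every `T > 0` the exactly self-similar function `ω(t,x) = (T−t)⁻¹ Ω(x/(T−t)^{1/3})` is a CLASSICAL solution of the
  inviscid gCLM `ω_t + ½ u ω_x = u_x ω`, `u_x = Hω` on `ℝ × [0,T)` (`IsGCLMLineSolution (1/2) 0 ω T`, slices `C² ∩ L¹`) from the
  smooth integrable odd datum `x ↦ T⁻¹Ω(x/T^{1/3})`, and `sup|ω(t,·)| → ∞` as `t ↑ T` (`SupNormBlowupBefore ω T`) —
  `exact_selfSimilar_blowup_half`.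
Ingredients, all in the tree: the algebraic core `SheetRowThirdExactFamily.rowResidual_third_eq_zero` (eng-5, p430429); the transform
facts `hilbertTransform_profile` (T1, p434965) for the library operator `Literature.Analysis.Fourier.hilbertTransform` (p433861); the
bridge `lineHilbert_eq_hilbertTransform_of_admissible` (p439102); admissibility of `C¹ ∩ L¹` profiles and «profile equation ⇒ classical
self-similar solution that blows up» (`GCLMSelfSimilarBlowup.lean`, `GCLMSelfSimilarAnsatz.lean`, profile-lit). WHAT THIS IS NOT: not NS;
not the viscous row (`ε > 0`, `a < 1/2`, time-dependent viscosity) — that one is `exactRow_solves_sheet_equation` at the profile level.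
-/

namespace Summit.NavierStokesRegularity.OSWSelfSimilar
namespace SheetRowThirdExactFamily

open _root_.MeasureTheory Set Filter
open Literature.Analysis.Fourier Literature.Analysis.FluidPDE
open scoped Real Topology

/-- The exact `a = 1/2` collapse profile is smooth: `x ↦ c·x/(1+x²)²` is `C^∞`. [folklore] -/
theorem contDiff_scaledProfile (c : ℝ) : ContDiff ℝ (⊤ : ℕ∞) (fun x : ℝ => c * profile x) := by
  unfold profile
  refine contDiff_const.mul (contDiff_id.div ?_ fun x => by positivity)
  exact (contDiff_const.add (contDiff_id.pow 2)).pow 2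

/-- … and integrable: `|x/(1+x²)²| ≤ ½ (1+x²)⁻¹`. [folklore] -/
theorem integrable_scaledProfile (c : ℝ) : Integrable (fun x : ℝ => c * profile x) := by
  refine Integrable.const_mul ?_ c
  refine Integrable.mono' (integrable_inv_one_add_sq.const_mul (1 / 2))
    ((contDiff_scaledProfile 1).continuous.aestronglyMeasurable.congr
      (Eventually.of_forall fun x => by simp)) (Eventually.of_forall fun x => ?_)
  unfold profile
  have hx : 0 < 1 + x ^ 2 := by positivity
  rw [Real.norm_eq_abs, abs_div, abs_of_pos (by positivity : (0:ℝ) < (1 + x ^ 2) ^ 2), div_le_iff₀ (by positivity)]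
  have h2 : |x| ≤ (1 + x ^ 2) / 2 := by
    cases le_or_gt 0 x with
    | inl h => rw [abs_of_nonneg h]; nlinarith [sq_nonneg (x - 1)]
    | inr h => rw [abs_of_neg h]; nlinarith [sq_nonneg (x + 1)]
  calc |x| ≤ (1 + x ^ 2) / 2 := h2
    _ = 1 / 2 * (1 + x ^ 2)⁻¹ * (1 + x ^ 2) ^ 2 := by field_simp

/-- The library Hilbert transform of the scaled profile, in the SPLIT spelling of the gCLM files:
`lineHilbert (c·f) = c·hilbProfile`. [folklore] -/
theorem lineHilbert_scaledProfile (c x : ℝ) :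
    lineHilbert (fun y : ℝ => c * profile y) x = c * hilbProfile x := by
  have hadm : HilbertPVAdmissible (fun y : ℝ => c * profile y) :=
    hilbertPVAdmissible_of_contDiff ((contDiff_scaledProfile c).of_le (by norm_cast))
      (integrable_scaledProfile c)
  rw [lineHilbert_eq_hilbertTransform_of_admissible hadm, hilbertTransform_const_mul, hilbertTransform_profile]

/-- The gCLM velocity of the scaled profile: `lineVelocity (c·f) X = c·𝒰_f(X)`. [folklore] -/
theorem lineVelocity_scaledProfile (c X : ℝ) :
    lineVelocity (fun y : ℝ => c * profile y) X = c * primProfile X := by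
  unfold lineVelocity
  simp_rw [lineHilbert_scaledProfile]
  have hderiv : ∀ y ∈ Set.uIcc 0 X, HasDerivAt (fun y => c * primProfile y) (c * hilbProfile y) y :=
    fun y _ => (hasDerivAt_primProfile y).const_mul c
  have hcont : Continuous fun y : ℝ => c * hilbProfile y := by
    unfold hilbProfile
    exact continuous_const.mul ((continuous_id.pow 2 |>.sub continuous_const).div
      (continuous_const.mul ((continuous_const.add (continuous_id.pow 2)).pow 2)) fun y => by positivity)
  rw [intervalIntegral.integral_eq_sub_of_hasDerivAt hderiv (hcont.intervalIntegrable _ _), primProfile_zero]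
  ring

/-- **The exact `a = 1/2` profile solves the self-similar profile equation of the inviscid gCLM at every point**:
`GCLMProfileEqAt (1/2) (1/3) (−1) Ω X` for `Ω = −(16/3)·x/(1+x²)²`. [cite: Chen2020DissipativeGCLM, eq. (2.3)] -/
theorem profileEq_half (X : ℝ) :
    GCLMProfileEqAt (1 / 2) (1 / 3) (-1) (fun y : ℝ => -(16 / 3) * profile y) X := by
  rw [gclmProfileEqAt_iff, lineVelocity_scaledProfile, lineHilbert_scaledProfile,
    ((hasDerivAt_profile X).const_mul (-(16 / 3) : ℝ)).deriv]
  -- the algebraic core at ε = 0, ℓ = 1, a = 1/2 (A = 8/(3a) = 16/3)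
  have key := rowResidual_third_eq_zero (a := (1 / 2 : ℝ)) (ε := 0) (ℓ := 1) (by norm_num) one_ne_zero
    (by norm_num) X
  unfold rowResidual at key
  have hA : (8 : ℝ) / (3 * (1 / 2)) = 16 / 3 := by norm_num
  rw [hA] at key
  simp only [one_pow, div_one, mul_one, one_mul, zero_mul, sub_zero] at key
  linear_combination key

/-- **UNCONDITIONAL exact self-similar blow-up of the inviscid gCLM at `a = 1/2`** (Chen 2020 (2.3) / LSS 2021 Thm 2, end to end):
for every `T > 0`, `ω(t,x) = (T−t)⁻¹Ω(x/(T−t)^{1/3})` with `Ω(x) = −(16/3)x/(1+x²)²` is a classical solution of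
`ω_t + ½uω_x = u_xω`, `u_x = Hω` on `ℝ × [0,T)` with `C² ∩ L¹` slices, and its sup norm blows up at `T`. MODEL theorem; not NS.
[cite: Chen2020DissipativeGCLM, eq. (2.3); LushnikovSilantyevSiegel2021, Thm. 2] -/
theorem exact_selfSimilar_blowup_half {T : ℝ} (hT : 0 < T) :
    IsGCLMLineSolution (1 / 2) 0 (gclmSelfSimilar (-1) (1 / 3) T (fun y : ℝ => -(16 / 3) * profile y)) T ∧
      SupNormBlowupBefore (gclmSelfSimilar (-1) (1 / 3) T (fun y : ℝ => -(16 / 3) * profile y)) T := by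
  have h2 : ContDiff ℝ 2 (fun y : ℝ => -(16 / 3) * profile y) :=
    (contDiff_scaledProfile _).of_le (by norm_cast)
  have hX₀ : (fun y : ℝ => -(16 / 3) * profile y) 1 ≠ 0 := by
    simp only [profile]
    norm_num
  exact ⟨isGCLMLineSolution_gclmSelfSimilar_of_contDiff hT h2 (integrable_scaledProfile _) profileEq_half,
    supNormBlowupBefore_gclmSelfSimilar hT hX₀⟩

end SheetRowThirdExactFamily
end Summit.NavierStokesRegularity.OSWSelfSimilar
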